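import Mathlib
import HarnessLib
import Summits.NavierStokesRegularity.NavierStokesRegularity.Theorems.PoloidalWindowRigidity.Negative.LogTwistGerm

/-!
# Crux `PoloidalWindowRigidity` (K2, stmt-NavierStokesRegularity-19708) — negative side: `hopen`, `hthick`, `hleaf` and S2 `stub_localThickTH` are FALSE
# WITHOUT THEIR MOMENTUM CLAUSE (witness: the log-twist germ of `…Negative.LogTwistGerm`)

Cell ns-regularity-ideate, seat ns-poloidal-K2-p4 gen 0 (THICK column; lead ns-poloidal-K2-p2; `--supports stmt-NavierStokesRegularity-19708`, negative
side).  `…Negative.LogTwistGerm.logTwistGerm_hypotheses` verifies in the kernel that the elementary field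
`V = (x² − xz + z²/2 + log((x−z)²+y²), −yz + 2·arctan((x−z)/y), (x−z)² + y²)` gives, as a steady germ on `U = ℝ × {y > 0}`, a real-analytic `u`
that is at every point poloidal along `e₃`, frozen, non-degenerate, twisting, hyperbolic, with `∇ₕΛ ≠ 0`, leafwise, `∂ₙΛ ≠ 0`, and time–height on NO
open subset.  Read off here, for the local statements to which this seat reduced the THICK column of crux 19708 / item 20428:

* `localHypThickOpen_false_without_momentum` — `hopen` (`…HyperbolicThickOfLocalOpen.stub_hyperbolicThick_of_localHypThickOpen`) with the clause
  `IsClassicalNSSolutionOnRegion U 1 0 u q` (and the then idle `q`) deleted is FALSE;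
* `localThickOpen_false_without_momentum` — the same for `hthick` (`…LrcModEntireTwistingThickOfLocalOpen.stub_twistingThick_of_localThickOpen`);
* `localThickLeaf_false_without_momentum` — the same for `hleaf` (`…TwistingThickLeafwise.stub_twistingThick_of_localThickLeaf`);
* `localThickTH_false_without_momentum` — the registered stub S2 `stub_localThickTH` of `Cruxes/PoloidalWindowRigidity/Lines/local_rigidity.lean` (v1)
  with its momentum clause deleted is FALSE.

So every certificate for the THICK column must consume the momentum equation (refuter1 K-48/K-49 had this numerically, j291279; here in closed form and in
the kernel), exactly as (M) is load-bearing for the class stubs (`…Negative.*FalseWithoutMild`, K-47/K-50).  The germ is steady and unbounded: it says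
nothing about the class-level stubs, and it is NOT a Navier–Stokes solution (vertical momentum residual with `log`/`arctan` terms, kit j292380 — not
claimed here).  WHAT THIS IS NOT: not a claim about Navier–Stokes regularity, not a refutation of any registered stub as registered. [folklore]
-/

noncomputable section

-- the summit and its single sub-problem share the name (CONVENTIONS §1), as in every Theorems file
set_option linter.dupNamespace false

namespace Summit.NavierStokesRegularity.NavierStokesRegularity.Theorems.PoloidalWindowRigidity.Negative.LogTwistGermFalseWithoutMomentum

open Set Function
open Summit.NavierStokesRegularity.NavierStokesRegularity.Theorems.PoloidalWindowRigidity.Negative.LogTwistGerm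
open scoped RealInnerProductSpace InnerProductSpace
open Literature.Analysis Literature.Analysis.FluidPDE

/-- **`hopen` WITHOUT ITS MOMENTUM CLAUSE is false.** -/
theorem localHypThickOpen_false_without_momentum :
    ¬ (∀ (u : ℝ → EuclideanSpace ℝ (Fin 3) → EuclideanSpace ℝ (Fin 3))
        (U : Set (ℝ × EuclideanSpace ℝ (Fin 3))),
        IsOpen U → U.Nonempty →
        AnalyticOnNhd ℝ (Function.uncurry u) U →
        (∀ p ∈ U, ⟪Literature.Analysis.FluidPDE.curl (u p.1) p.2, EuclideanSpace.single 2 1⟫_ℝ = 0) →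
        (∀ p ∈ U, fderiv ℝ (u p.1) p.2 (EuclideanSpace.single 2 1) 0 * fderiv ℝ (u p.1) p.2 (EuclideanSpace.single 1 1) 2 =
          fderiv ℝ (u p.1) p.2 (EuclideanSpace.single 2 1) 1 * fderiv ℝ (u p.1) p.2 (EuclideanSpace.single 0 1) 2) →
        (∀ p ∈ U, Literature.Analysis.FluidPDE.curl (u p.1) p.2 ≠ 0 ∧
          (fderiv ℝ (u p.1) p.2 (EuclideanSpace.single 0 1) 2 ≠ 0 ∨ fderiv ℝ (u p.1) p.2 (EuclideanSpace.single 1 1) 2 ≠ 0) ∧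
          (fderiv ℝ (u p.1) p.2 (EuclideanSpace.single 2 1) 0 ≠ 0 ∨ fderiv ℝ (u p.1) p.2 (EuclideanSpace.single 2 1) 1 ≠ 0)) →
        (∀ p ∈ U,
          fderiv ℝ (fun y => fderiv ℝ (u p.1) y (EuclideanSpace.single 2 1) 2) p.2 (EuclideanSpace.single 0 1) *
              fderiv ℝ (u p.1) p.2 (EuclideanSpace.single 1 1) 2 -
            fderiv ℝ (fun y => fderiv ℝ (u p.1) y (EuclideanSpace.single 2 1) 2) p.2 (EuclideanSpace.single 1 1) *
              fderiv ℝ (u p.1) p.2 (EuclideanSpace.single 0 1) 2 ≠ 0) →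
        (∀ p ∈ U,
          fderiv ℝ (u p.1) p.2 (EuclideanSpace.single 2 1) 0 * fderiv ℝ (u p.1) p.2 (EuclideanSpace.single 0 1) 2 +
            fderiv ℝ (u p.1) p.2 (EuclideanSpace.single 2 1) 1 * fderiv ℝ (u p.1) p.2 (EuclideanSpace.single 1 1) 2 < 0) →
        (∀ p ∈ U,
          fderiv ℝ (fun y => (fderiv ℝ (u p.1) y (EuclideanSpace.single 2 1) 0 * fderiv ℝ (u p.1) y (EuclideanSpace.single 0 1) 2 +
              fderiv ℝ (u p.1) y (EuclideanSpace.single 2 1) 1 * fderiv ℝ (u p.1) y (EuclideanSpace.single 1 1) 2) /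
            (fderiv ℝ (u p.1) y (EuclideanSpace.single 0 1) 2 ^ 2 + fderiv ℝ (u p.1) y (EuclideanSpace.single 1 1) 2 ^ 2)) p.2 (EuclideanSpace.single 0 1) ≠ 0 ∨
          fderiv ℝ (fun y => (fderiv ℝ (u p.1) y (EuclideanSpace.single 2 1) 0 * fderiv ℝ (u p.1) y (EuclideanSpace.single 0 1) 2 +
              fderiv ℝ (u p.1) y (EuclideanSpace.single 2 1) 1 * fderiv ℝ (u p.1) y (EuclideanSpace.single 1 1) 2) /
            (fderiv ℝ (u p.1) y (EuclideanSpace.single 0 1) 2 ^ 2 + fderiv ℝ (u p.1) y (EuclideanSpace.single 1 1) 2 ^ 2)) p.2 (EuclideanSpace.single 1 1) ≠ 0) →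
        False) := by
  intro h
  obtain ⟨u, U, hU, hne, han, hpol, hfr, hnd, htw, hhyp, hpin, -, -, -⟩ := logTwistGerm_hypotheses
  exact h u U hU hne han hpol hfr hnd htw hhyp hpin

/-- **`hthick` WITHOUT ITS MOMENTUM CLAUSE is false.** -/
theorem localThickOpen_false_without_momentum :
    ¬ (∀ (u : ℝ → EuclideanSpace ℝ (Fin 3) → EuclideanSpace ℝ (Fin 3))
        (U : Set (ℝ × EuclideanSpace ℝ (Fin 3))),
        IsOpen U → U.Nonempty →
        AnalyticOnNhd ℝ (Function.uncurry u) U →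
        (∀ p ∈ U, ⟪Literature.Analysis.FluidPDE.curl (u p.1) p.2, EuclideanSpace.single 2 1⟫_ℝ = 0) →
        (∀ p ∈ U, fderiv ℝ (u p.1) p.2 (EuclideanSpace.single 2 1) 0 * fderiv ℝ (u p.1) p.2 (EuclideanSpace.single 1 1) 2 =
          fderiv ℝ (u p.1) p.2 (EuclideanSpace.single 2 1) 1 * fderiv ℝ (u p.1) p.2 (EuclideanSpace.single 0 1) 2) →
        (∀ p ∈ U, Literature.Analysis.FluidPDE.curl (u p.1) p.2 ≠ 0 ∧
          (fderiv ℝ (u p.1) p.2 (EuclideanSpace.single 0 1) 2 ≠ 0 ∨ fderiv ℝ (u p.1) p.2 (EuclideanSpace.single 1 1) 2 ≠ 0) ∧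
          (fderiv ℝ (u p.1) p.2 (EuclideanSpace.single 2 1) 0 ≠ 0 ∨ fderiv ℝ (u p.1) p.2 (EuclideanSpace.single 2 1) 1 ≠ 0)) →
        (∀ p ∈ U,
          fderiv ℝ (fun y => fderiv ℝ (u p.1) y (EuclideanSpace.single 2 1) 2) p.2 (EuclideanSpace.single 0 1) *
              fderiv ℝ (u p.1) p.2 (EuclideanSpace.single 1 1) 2 -
            fderiv ℝ (fun y => fderiv ℝ (u p.1) y (EuclideanSpace.single 2 1) 2) p.2 (EuclideanSpace.single 1 1) *
              fderiv ℝ (u p.1) p.2 (EuclideanSpace.single 0 1) 2 ≠ 0) →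
        (∀ p ∈ U,
          fderiv ℝ (fun y => (fderiv ℝ (u p.1) y (EuclideanSpace.single 2 1) 0 * fderiv ℝ (u p.1) y (EuclideanSpace.single 0 1) 2 +
              fderiv ℝ (u p.1) y (EuclideanSpace.single 2 1) 1 * fderiv ℝ (u p.1) y (EuclideanSpace.single 1 1) 2) /
            (fderiv ℝ (u p.1) y (EuclideanSpace.single 0 1) 2 ^ 2 + fderiv ℝ (u p.1) y (EuclideanSpace.single 1 1) 2 ^ 2)) p.2 (EuclideanSpace.single 0 1) ≠ 0 ∨
          fderiv ℝ (fun y => (fderiv ℝ (u p.1) y (EuclideanSpace.single 2 1) 0 * fderiv ℝ (u p.1) y (EuclideanSpace.single 0 1) 2 +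
              fderiv ℝ (u p.1) y (EuclideanSpace.single 2 1) 1 * fderiv ℝ (u p.1) y (EuclideanSpace.single 1 1) 2) /
            (fderiv ℝ (u p.1) y (EuclideanSpace.single 0 1) 2 ^ 2 + fderiv ℝ (u p.1) y (EuclideanSpace.single 1 1) 2 ^ 2)) p.2 (EuclideanSpace.single 1 1) ≠ 0) →
        False) := by
  intro h
  obtain ⟨u, U, hU, hne, han, hpol, hfr, hnd, htw, -, hpin, -, -, -⟩ := logTwistGerm_hypotheses
  exact h u U hU hne han hpol hfr hnd htw hpin

/-- **`hleaf` WITHOUT ITS MOMENTUM CLAUSE is false.** -/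
theorem localThickLeaf_false_without_momentum :
    ¬ (∀ (u : ℝ → EuclideanSpace ℝ (Fin 3) → EuclideanSpace ℝ (Fin 3))
        (U : Set (ℝ × EuclideanSpace ℝ (Fin 3))),
        IsOpen U → U.Nonempty →
        AnalyticOnNhd ℝ (Function.uncurry u) U →
        (∀ p ∈ U, ⟪Literature.Analysis.FluidPDE.curl (u p.1) p.2, EuclideanSpace.single 2 1⟫_ℝ = 0) →
        (∀ p ∈ U, fderiv ℝ (u p.1) p.2 (EuclideanSpace.single 2 1) 0 * fderiv ℝ (u p.1) p.2 (EuclideanSpace.single 1 1) 2 =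
          fderiv ℝ (u p.1) p.2 (EuclideanSpace.single 2 1) 1 * fderiv ℝ (u p.1) p.2 (EuclideanSpace.single 0 1) 2) →
        (∀ p ∈ U, Literature.Analysis.FluidPDE.curl (u p.1) p.2 ≠ 0 ∧
          (fderiv ℝ (u p.1) p.2 (EuclideanSpace.single 0 1) 2 ≠ 0 ∨ fderiv ℝ (u p.1) p.2 (EuclideanSpace.single 1 1) 2 ≠ 0) ∧
          (fderiv ℝ (u p.1) p.2 (EuclideanSpace.single 2 1) 0 ≠ 0 ∨ fderiv ℝ (u p.1) p.2 (EuclideanSpace.single 2 1) 1 ≠ 0)) →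
        (∀ p ∈ U,
          fderiv ℝ (fun y => fderiv ℝ (u p.1) y (EuclideanSpace.single 2 1) 2) p.2 (EuclideanSpace.single 0 1) *
              fderiv ℝ (u p.1) p.2 (EuclideanSpace.single 1 1) 2 -
            fderiv ℝ (fun y => fderiv ℝ (u p.1) y (EuclideanSpace.single 2 1) 2) p.2 (EuclideanSpace.single 1 1) *
              fderiv ℝ (u p.1) p.2 (EuclideanSpace.single 0 1) 2 ≠ 0) →
        (∀ p ∈ U,
          fderiv ℝ (fun y => (fderiv ℝ (u p.1) y (EuclideanSpace.single 2 1) 0 * fderiv ℝ (u p.1) y (EuclideanSpace.single 0 1) 2 +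
              fderiv ℝ (u p.1) y (EuclideanSpace.single 2 1) 1 * fderiv ℝ (u p.1) y (EuclideanSpace.single 1 1) 2) /
            (fderiv ℝ (u p.1) y (EuclideanSpace.single 0 1) 2 ^ 2 + fderiv ℝ (u p.1) y (EuclideanSpace.single 1 1) 2 ^ 2)) p.2 (EuclideanSpace.single 0 1) * fderiv ℝ (u p.1) p.2 (EuclideanSpace.single 1 1) 2 =
          fderiv ℝ (fun y => (fderiv ℝ (u p.1) y (EuclideanSpace.single 2 1) 0 * fderiv ℝ (u p.1) y (EuclideanSpace.single 0 1) 2 +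
              fderiv ℝ (u p.1) y (EuclideanSpace.single 2 1) 1 * fderiv ℝ (u p.1) y (EuclideanSpace.single 1 1) 2) /
            (fderiv ℝ (u p.1) y (EuclideanSpace.single 0 1) 2 ^ 2 + fderiv ℝ (u p.1) y (EuclideanSpace.single 1 1) 2 ^ 2)) p.2 (EuclideanSpace.single 1 1) * fderiv ℝ (u p.1) p.2 (EuclideanSpace.single 0 1) 2) →
        (∀ p ∈ U,
          fderiv ℝ (fun y => (fderiv ℝ (u p.1) y (EuclideanSpace.single 2 1) 0 * fderiv ℝ (u p.1) y (EuclideanSpace.single 0 1) 2 +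
              fderiv ℝ (u p.1) y (EuclideanSpace.single 2 1) 1 * fderiv ℝ (u p.1) y (EuclideanSpace.single 1 1) 2) /
            (fderiv ℝ (u p.1) y (EuclideanSpace.single 0 1) 2 ^ 2 + fderiv ℝ (u p.1) y (EuclideanSpace.single 1 1) 2 ^ 2)) p.2 (EuclideanSpace.single 0 1) * fderiv ℝ (u p.1) p.2 (EuclideanSpace.single 0 1) 2 +
          fderiv ℝ (fun y => (fderiv ℝ (u p.1) y (EuclideanSpace.single 2 1) 0 * fderiv ℝ (u p.1) y (EuclideanSpace.single 0 1) 2 +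
              fderiv ℝ (u p.1) y (EuclideanSpace.single 2 1) 1 * fderiv ℝ (u p.1) y (EuclideanSpace.single 1 1) 2) /
            (fderiv ℝ (u p.1) y (EuclideanSpace.single 0 1) 2 ^ 2 + fderiv ℝ (u p.1) y (EuclideanSpace.single 1 1) 2 ^ 2)) p.2 (EuclideanSpace.single 1 1) * fderiv ℝ (u p.1) p.2 (EuclideanSpace.single 1 1) 2 ≠ 0) →
        False) := by
  intro h
  obtain ⟨u, U, hU, hne, han, hpol, hfr, hnd, htw, -, -, hleaf, hdn, -⟩ := logTwistGerm_hypotheses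
  exact h u U hU hne han hpol hfr hnd htw hleaf hdn

/-- **S2 `stub_localThickTH` (local_rigidity v1) WITHOUT ITS MOMENTUM CLAUSE is false**: the log-twist germ is poloidal, analytic, non-degenerate and
twisting on `ℝ × {y > 0}` but time–height on NO nonempty open subset. -/
theorem localThickTH_false_without_momentum :
    ¬ (    ∀ (u : ℝ → EuclideanSpace ℝ (Fin 3) → EuclideanSpace ℝ (Fin 3))
      (U : Set (ℝ × EuclideanSpace ℝ (Fin 3))),
      IsOpen U → U.Nonempty →
      AnalyticOnNhd ℝ (Function.uncurry u) U →
      (∀ p ∈ U, ⟪Literature.Analysis.FluidPDE.curl (u p.1) p.2, EuclideanSpace.single 2 1⟫_ℝ = 0) →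
      (∀ p ∈ U, Literature.Analysis.FluidPDE.curl (u p.1) p.2 ≠ 0 ∧
        (fderiv ℝ (u p.1) p.2 (EuclideanSpace.single 0 1) 2 ≠ 0 ∨ fderiv ℝ (u p.1) p.2 (EuclideanSpace.single 1 1) 2 ≠ 0) ∧
        (fderiv ℝ (u p.1) p.2 (EuclideanSpace.single 2 1) 0 ≠ 0 ∨ fderiv ℝ (u p.1) p.2 (EuclideanSpace.single 2 1) 1 ≠ 0)) →
      (∀ p ∈ U,
        fderiv ℝ (fun y => fderiv ℝ (u p.1) y (EuclideanSpace.single 2 1) 2) p.2 (EuclideanSpace.single 0 1) *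
            fderiv ℝ (u p.1) p.2 (EuclideanSpace.single 1 1) 2 -
          fderiv ℝ (fun y => fderiv ℝ (u p.1) y (EuclideanSpace.single 2 1) 2) p.2 (EuclideanSpace.single 1 1) *
            fderiv ℝ (u p.1) p.2 (EuclideanSpace.single 0 1) 2 ≠ 0) →
      ∃ U₁ : Set (ℝ × EuclideanSpace ℝ (Fin 3)), U₁ ⊆ U ∧ IsOpen U₁ ∧ U₁.Nonempty ∧
        ∃ m : ℝ → ℝ → ℝ, ∀ p ∈ U₁, ∀ b : Fin 3, b ≠ 2 →
          fderiv ℝ (u p.1) p.2 (EuclideanSpace.single 2 1) b =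
            m p.1 (p.2 2) * fderiv ℝ (u p.1) p.2 (EuclideanSpace.single b 1) 2) := by
  intro h
  obtain ⟨u, U, hU, hne, han, hpol, -, hnd, htw, -, -, -, -, hno⟩ := logTwistGerm_hypotheses
  obtain ⟨U₁, hU₁U, hU₁o, hU₁ne, m, hm⟩ := h u U hU hne han hpol hnd htw
  obtain ⟨p, hp, b, hb, hneq⟩ := hno U₁ hU₁U hU₁o hU₁ne m
  exact hneq (hm p hp b hb)

end Summit.NavierStokesRegularity.NavierStokesRegularity.Theorems.PoloidalWindowRigidity.Negative.LogTwistGermFalseWithoutMomentum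

end
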